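/-
Copyright (c) 2026 the pub-hodgecm-mathlib formalisation cell (harness21).  Prover seat hodgecm-mathlib-K2Liu-p08 (g6), Track B «K2-LIT»,
#184♮ = hLiu418 = `stmt-HodgeConjecture-24832`; #42S BLOCK D, row D-2, (σ-A) mini-road (LEAD F0P6-plan (g15) RULING M-160f ∕ BATCH #238; (σ-A) road desk
K2Liu-p25 (g3) WORDs #29, #32), brick (an-3c-int) sibling: THE `L¹` LETTER (I1) (the `ζ ↔ s` Fubini) of ★ p864562 `coneWord_of_stageLetters`.
THEOREMS ONLY (no `def`, no `instance`, no `notation`, no named-fact hypothesis, no `sorry`, default heartbeats).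
-/
import Summits.HodgeConjecture.HodgeConjecture.Theorems.K2LiuConeWordIntegrability   -- (an-3c-int) (I2): box scaling, vertex law as a shell letter, slice support
import HarnessLib

/-!
# Crux `HLiu418`, #42S BLOCK D, row D-2, (σ-A) brick (an-3c-int), letter (I1): THE VECTOR VALUES ALONG THE GRAPH `(ζ·s) ⊔ s` ARE `L¹` ON `μ^κ ⊗ σ`

Cell `hodgecm-mathlib`, crux item hLiu418 = `stmt-HodgeConjecture-24832` (helper lane `--supports … --as helper`, count-neutral; closes no socket); squad K2 ∕ K2Liu (L1).
Prover K2Liu-p08 (g6) = pen of [A4]∕(an-3) under the (σ-A) road desk K2Liu-p25 (g3).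

THE POINT.  ★ p864562's letter (I1) — `Integrable (uncurry fun ζ s => V_x((Z_s ζ) ⊔ s)) (μ^κ ⊗ σ)` — from the same primitive letters as (I2): (L3)'s shape
`V_x(q₁ ⊔ q₂) = γ·∫_t ψ(t ⬝ᵥ q₁)·Θ_x(t ⊔ q₂)` (`= γ·𝓕(Θ_x(· ⊔ q₂))(q₁)`, (W-w₂)@point ∘ ★ p864180), `Θ_x ∈ 𝒮(F^ι)`, `Z_s` jointly continuous with the LOWER-BOUND
letter ((an-3c-charts) (iii)), and (an-1)'s null-cone letters.  MECHANISM: `Θ_x` is invariant under a lattice `(𝔭^{N₁})^ι` UNIFORMLY, so every slice `Θ_x(· ⊔ s)` is, and its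
Fourier transform VANISHES off the dual box `(𝔭^{m−N₁})^{ι₁}` (★ `piFourierSB_eq_zero_of_notMem`) and is bounded by `M·μ^{ι₁}((𝔭^{N})^{ι₁})`; so the `ζ`-fibre of
`|V_x((Z_s ζ) ⊔ s)|` has mass `≤ C·μ^κ{ζ : Z_s ζ ∈ dual box} ≤ C·μ^κ((𝔭^{m−N₁−level s−c₀})^κ) ≍ q^{card κ·level s}` — the SAME shell structure as (I2), summed against the
vertex law by ★ p864503 §3, Tonelli §4, then `integrable_swap_iff`.
* §1 slice lattice invariance + the transform's support and bound; §2 **`integrable_vectorAlongGraph`** = (I1).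
[WeilBNT1967, Chap. VII §2 Prop. 2, Cor. 1] [Weil1965, Chap. III n° 37 Prop. 6] [KudlaRallis1994, §2 (2.10)–(2.12)].
HONEST LABEL.  Count-neutral helper; letters BY VALUE as in (I2); `HC_CM` is proved only modulo the 7 printed citations (2 remaining named inputs: hLiu418 =
`stmt-HodgeConjecture-24832`, h413 = `stmt-HodgeConjecture-24833`) until rung 0 closes.

## References
* [WeilBNT1967] A. Weil, *Basic Number Theory* (1967), Chap. VII §2 Prop. 2 and Cor. 1.
* [Weil1965] A. Weil, *Sur la formule de Siegel dans la théorie des groupes classiques*, Acta Math. 113 (1965), Chap. III n° 37 Prop. 6.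
* [KudlaRallis1994] S. Kudla, S. Rallis, *A regularized Siegel–Weil formula: the first term identity*, Ann. of Math. 140 (1994), §2 (2.10)–(2.12).
-/

set_option autoImplicit false
set_option linter.dupNamespace false -- the mandated namespace repeats `HodgeConjecture.HodgeConjecture`

noncomputable section

open MeasureTheory Set Filter Function
open scoped Matrix NNReal ENNReal
open Literature.NumberTheory.Automorphic
open Literature.NumberTheory.GaloisRepresentations Literature.NumberTheory.GaloisRepresentations.IsNonarchimedeanLocalField
open Literature.RepresentationTheory.HeisenbergGroup
open Literature.NumberTheory.Weil1965.SplitPlace (level mem_shell_level le_level_of_mem level_eq_of_mem_shell)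
open Summit.HodgeConjecture.HodgeConjecture.Cruxes.HLiu418
open Summit.HodgeConjecture.HodgeConjecture.Cruxes.HLiu418.K2LiuConeVertexFubini
open Summit.HodgeConjecture.HodgeConjecture.Cruxes.HLiu418.K2LiuConeWordIntegrability

namespace Summit.HodgeConjecture.HodgeConjecture.Cruxes.HLiu418.K2LiuConeWordIntegrabilityZeta

variable {F : Type*} [Field F] [ValuativeRel F] [TopologicalSpace F] [IsNonarchimedeanLocalField F]
  [MeasurableSpace F] [BorelSpace F] (μ : Measure F) [μ.IsAddHaarMeasure]
  {κ ι₁ ι₁' ι : Type*} [Fintype κ] [Fintype ι₁] [Fintype ι₁'] [Fintype ι] (e : ι₁ ⊕ ι₁' ≃ ι)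

/-! ## §1 Slices: lattice invariance, support and bound of their Fourier transforms -/

section Slices

omit [MeasurableSpace F] [BorelSpace F] [Fintype κ] [Fintype ι] [Fintype ι₁] [Fintype ι₁'] in
/-- a UNIFORM lattice invariance of `Θ` on `F^ι` descends to every slice `t ↦ Θ(t ⊔ s)`. [cite: WeilBNT1967, Chap. VII §2, Prop. 2] -/
theorem slice_add_eq {Θ : (ι → F) → ℂ} {N₁ : ℤ} (hinv : ∀ v : ι → F, ∀ w ∈ piPrimePowBall F ι N₁, Θ (v + w) = Θ v) (s : ι₁' → F)
    (t : ι₁ → F) (t' : ι₁ → F) (ht' : t' ∈ piPrimePowBall F ι₁ N₁) : Θ (glue e (t + t') s) = Θ (glue e t s) := by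
  have hglue : glue e (t + t') s = glue e t s + glue e t' 0 := by
    rw [glue_add, add_zero]
  have hmem : glue e t' (0 : ι₁' → F) ∈ piPrimePowBall F ι N₁ := by
    rw [mem_piPrimePowBall_iff_resL_resR F e, resL_glue, resR_glue]
    exact ⟨ht', zero_mem_piPrimePowBall _⟩
  rw [hglue, hinv _ _ hmem]

omit [Fintype ι₁'] [Fintype ι] in
/-- **THE SLICE TRANSFORM IS BOUNDED BY `M · μ^{ι₁}((𝔭^N)^{ι₁})` AND VANISHES UNLESS `s ∈ (𝔭^N)^{ι₁′}`** (`|Θ| ≤ M`, `Θ` supported in `(𝔭^N)^ι`).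
[cite: WeilBNT1967, Chap. VII §2, Prop. 2] -/
theorem norm_piFourierSB_slice_le {ψ : AddChar F Circle} {Θ : (ι → F) → ℂ} (hΘ : Θ ∈ SchwartzBruhat (ι → F))
    {M : ℝ} (hM : ∀ v, ‖Θ v‖ ≤ M) {N : ℤ} (hsupp : ∀ v, v ∉ piPrimePowBall F ι N → Θ v = 0) (s : ι₁' → F) (η : ι₁ → F) :
    ‖piFourierSB ψ (Measure.pi fun _ : ι₁ => μ) (fun t : ι₁ → F => Θ (glue e t s)) η‖ ≤
      (piPrimePowBall F ι₁' N).indicator (fun _ => M * (Measure.pi fun _ : ι₁ => μ).real (piPrimePowBall F ι₁ N)) s := by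
  haveI : T2Space F := (isLocalField F).toT2Space
  haveI : SecondCountableTopology F := secondCountableTopology_localField F
  have hslice : (fun t : ι₁ → F => Θ (glue e t s)) ∈ SchwartzBruhat (ι₁ → F) := K2LiuLocalPiGlueFubini.sliceL_mem_schwartzBruhat e hΘ s
  by_cases hs : s ∈ piPrimePowBall F ι₁' N
  · rw [indicator_of_mem hs, piFourierSB_apply]
    have hpt : ∀ t : ι₁ → F, ‖((ψ (t ⬝ᵥ η) : Circle) : ℂ) * Θ (glue e t s)‖ ≤ (piPrimePowBall F ι₁ N).indicator (fun _ => M) t := by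
      intro t
      rw [norm_mul, Circle.norm_coe, one_mul]
      by_cases ht : t ∈ piPrimePowBall F ι₁ N
      · rw [indicator_of_mem ht]; exact hM _
      · have h0 : Θ (glue e t s) = 0 := by
          by_contra hne
          exact ht (slice_support e hsupp t s hne).1
        rw [indicator_of_notMem ht, h0, norm_zero]
    have hint : Integrable ((piPrimePowBall F ι₁ N).indicator fun _ : ι₁ → F => M) (Measure.pi fun _ : ι₁ => μ) :=
      (integrableOn_const (hs := (measure_piPrimePowBall_lt_top _ N).ne)).integrable_indicator (measurableSet_piPrimePowBall N)
    calc ‖∫ t, ((ψ (t ⬝ᵥ η) : Circle) : ℂ) * Θ (glue e t s) ∂(Measure.pi fun _ : ι₁ => μ)‖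
        ≤ ∫ t, (piPrimePowBall F ι₁ N).indicator (fun _ => M) t ∂(Measure.pi fun _ : ι₁ => μ) :=
          norm_integral_le_of_norm_le hint (Eventually.of_forall hpt)
      _ = M * (Measure.pi fun _ : ι₁ => μ).real (piPrimePowBall F ι₁ N) := by
          rw [integral_indicator_const _ (measurableSet_piPrimePowBall N), smul_eq_mul, mul_comm]
  · rw [indicator_of_notMem hs]
    have h0 : (fun t : ι₁ → F => Θ (glue e t s)) = fun _ => 0 := by
      funext t
      by_contra hne
      exact hs (slice_support e hsupp t s hne).2
    rw [h0, piFourierSB_apply]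
    simp

omit [Fintype ι] [Fintype ι₁'] in
/-- **THE SLICE TRANSFORM VANISHES OFF THE DUAL BOX**: with `Θ` invariant under `(𝔭^{N₁})^ι` and `ψ` of conductor exponent `m`, `𝓕(Θ(· ⊔ s))(η) = 0` for
`η ∉ (𝔭^{m−N₁})^{ι₁}` (★ `piFourierSB_eq_zero_of_notMem`). [cite: WeilBNT1967, Chap. VII §2, Prop. 2] -/
theorem piFourierSB_slice_eq_zero_of_notMem {ψ : AddChar F Circle} {m : ℤ} (hm : ψ.HasConductorExp m) {Θ : (ι → F) → ℂ} {N₁ : ℤ}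
    (hinv : ∀ v : ι → F, ∀ w ∈ piPrimePowBall F ι N₁, Θ (v + w) = Θ v) (s : ι₁' → F) {η : ι₁ → F} (hη : η ∉ piPrimePowBall F ι₁ (m - N₁)) :
    piFourierSB ψ (Measure.pi fun _ : ι₁ => μ) (fun t : ι₁ → F => Θ (glue e t s)) η = 0 := by
  haveI : SecondCountableTopology F := secondCountableTopology_localField F
  exact piFourierSB_eq_zero_of_notMem ψ (Measure.pi fun _ : ι₁ => μ) hm (fun t t' ht' => slice_add_eq e hinv s t t' ht') hη

end Slices

/-! ## §2 (I1): the vector values along the graph are `L¹` on `μ^κ ⊗ σ` -/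

section I1

variable [Nonempty ι₁']

/-- **(I1) — THE VECTOR VALUES ALONG THE GRAPH `(Z_s ζ) ⊔ s` ARE `L¹` ON `μ^κ ⊗ σ`.**  `V` continuous on `F^ι` with (L3)'s shape
`V(q₁ ⊔ q₂) = γ·∫_t ψ(t ⬝ᵥ q₁)·Θ(t ⊔ q₂) dμ^{ι₁}` for a `Θ ∈ 𝒮(F^ι)` and `ψ` of conductor exponent `m`; `Z_s` jointly continuous with the LOWER-BOUND letter
`∀ s ≠ 0, ∀ N ζ, Z_s ζ ∈ (𝔭^N)^{ι₁} → ζ ∈ (𝔭^{N − level s − c₀})^κ`; `σ` finite on compacts, s-finite, `σ{0} = 0`, with (an-1)'s vertex law; `card κ + 2 < card ι₁′`.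
THEN **`Integrable (uncurry fun ζ s => V((Z_s ζ) ⊔ s)) (μ^κ ⊗ σ)`** — ★ p864562's letter `hI1`. [cite: Weil1965, Chap. III n° 37 Prop. 6]
[cite: WeilBNT1967, Chap. VII §2, Cor. 1] [cite: KudlaRallis1994, §2 (2.10)–(2.12)] -/
theorem integrable_vectorAlongGraph {ψ : AddChar F Circle} {m : ℤ} (hm : ψ.HasConductorExp m)
    (σ : Measure (ι₁' → F)) [IsFiniteMeasureOnCompacts σ] [SFinite σ] (hσ0 : σ {0} = 0)
    (hlaw : ∀ n : ℤ, σ.real (piPrimePowBall F ι₁' (n + 1)) =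
      (((residueFieldCard F : ℝ) ^ Fintype.card ι₁')⁻¹ * (residueFieldCard F : ℝ) ^ 2) * σ.real (piPrimePowBall F ι₁' n))
    (Zm : (ι₁' → F) → ((κ → F) →ₗ[F] (ι₁ → F))) (hZc : Continuous fun p : (ι₁' → F) × (κ → F) => Zm p.1 p.2) (c₀ : ℤ)
    (hZlow : ∀ s : ι₁' → F, s ≠ 0 → ∀ (N : ℤ) (ζ : κ → F), Zm s ζ ∈ piPrimePowBall F ι₁ N → ζ ∈ piPrimePowBall F κ (N - level s - c₀))
    (hnum : Fintype.card κ + 2 < Fintype.card ι₁')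
    (Θ : SchwartzBruhat (ι → F)) (V : (ι → F) → ℂ) (hVc : Continuous V) (γ : ℂ)
    (hV : ∀ (q₁ : ι₁ → F) (q₂ : ι₁' → F),
      V (glue e q₁ q₂) = γ * ∫ t, ((ψ (t ⬝ᵥ q₁) : Circle) : ℂ) * (Θ : (ι → F) → ℂ) (glue e t q₂) ∂(Measure.pi fun _ : ι₁ => μ)) :
    Integrable (uncurry fun (ζ : κ → F) (s : ι₁' → F) => V (glue e (Zm s ζ) s)) ((Measure.pi fun _ : κ => μ).prod σ) := by
  haveI : T2Space F := (isLocalField F).toT2Space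
  haveI : SecondCountableTopology F := secondCountableTopology_localField F
  -- data of `Θ`: a bound, a support box, a uniform invariance lattice
  obtain ⟨M, hM⟩ := Θ.2.1.continuous.bounded_above_of_compact_support Θ.2.2
  have hM0 : 0 ≤ M := (norm_nonneg _).trans (hM 0)
  obtain ⟨N, hN⟩ := exists_eq_zero_of_notMem_piPrimePowBall Θ.2
  obtain ⟨N₁, hN₁⟩ := exists_forall_add_eq_of_mem_schwartzBruhat_pi Θ.2
  have hq1 : (1 : ℝ) < (residueFieldCard F : ℝ) := by exact_mod_cast one_lt_residueFieldCard F
  have hq0 : (0 : ℝ) < (residueFieldCard F : ℝ) := zero_lt_one.trans hq1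
  -- the pointwise bound of `V` along the graph
  set K₁ : ℝ := ‖γ‖ * (M * (Measure.pi fun _ : ι₁ => μ).real (piPrimePowBall F ι₁ N)) with hK₁
  have hK₁0 : 0 ≤ K₁ := by positivity
  have hVbound : ∀ (s : ι₁' → F) (ζ : κ → F), ‖V (glue e (Zm s ζ) s)‖ₑ ≤
      (piPrimePowBall F ι₁' N).indicator (fun _ => {ζ' : κ → F | Zm s ζ' ∈ piPrimePowBall F ι₁ (m - N₁)}.indicator (fun _ => ENNReal.ofReal K₁) ζ) s := by
    intro s ζ
    rw [hV, ← piFourierSB_apply]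
    by_cases hs : s ∈ piPrimePowBall F ι₁' N
    · rw [indicator_of_mem hs]
      by_cases hζ : Zm s ζ ∈ piPrimePowBall F ι₁ (m - N₁)
      · rw [indicator_of_mem (show ζ ∈ {ζ' : κ → F | Zm s ζ' ∈ piPrimePowBall F ι₁ (m - N₁)} from hζ), ← ofReal_norm, norm_mul]
        refine ENNReal.ofReal_le_ofReal (mul_le_mul_of_nonneg_left ?_ (norm_nonneg _))
        have h := norm_piFourierSB_slice_le μ e (ψ := ψ) Θ.2 hM hN s (Zm s ζ)
        rwa [indicator_of_mem hs] at h
      · rw [indicator_of_notMem (show ζ ∉ {ζ' : κ → F | Zm s ζ' ∈ piPrimePowBall F ι₁ (m - N₁)} from hζ),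
          piFourierSB_slice_eq_zero_of_notMem μ e hm hN₁ s hζ, mul_zero, enorm_zero]
    · rw [indicator_of_notMem hs]
      have h := norm_piFourierSB_slice_le μ e (ψ := ψ) Θ.2 hM hN s (Zm s ζ)
      rw [indicator_of_notMem hs] at h
      have h0 : piFourierSB ψ (Measure.pi fun _ : ι₁ => μ) (fun t : ι₁ → F => (Θ : (ι → F) → ℂ) (glue e t s)) (Zm s ζ) = 0 :=
        norm_le_zero_iff.1 h
      rw [h0, mul_zero, enorm_zero]
  -- the swapped integrability on `σ ⊗ μ^κ`, by fibre bounds and the vertex summation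
  have hswap : Integrable (fun p : (ι₁' → F) × (κ → F) => V (glue e (Zm p.1 p.2) p.1)) (σ.prod (Measure.pi fun _ : κ => μ)) := by
    set f : (ι₁' → F) → ℝ≥0∞ := fun s =>
      ENNReal.ofReal (K₁ * (Measure.pi fun _ : κ => μ).real (piPrimePowBall F κ (m - N₁ - level s - c₀))) with hf
    set W : (ι₁' → F) → ℝ≥0∞ := fun s => ({0} : Set (ι₁' → F)).indicator (fun _ => ∞) s + (piPrimePowBall F ι₁' N).indicator f s with hW
    refine integrable_prod_of_lintegral_fibre_le σ (Measure.pi fun _ : κ => μ) ?_ W (fun s => ?_) ?_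
    · exact (hVc.comp ((continuous_glue e).comp (hZc.prodMk continuous_fst))).aestronglyMeasurable
    · by_cases hs0 : s = 0
      · subst hs0
        rw [hW]
        simp only [indicator_of_mem (mem_singleton _), top_add]
        exact le_top
      by_cases hsN : s ∈ piPrimePowBall F ι₁' N
      · have hset : {ζ' : κ → F | Zm s ζ' ∈ piPrimePowBall F ι₁ (m - N₁)} ⊆ piPrimePowBall F κ (m - N₁ - level s - c₀) :=
          fun ζ hζ => hZlow s hs0 (m - N₁) ζ hζ
        have hmeas : MeasurableSet {ζ' : κ → F | Zm s ζ' ∈ piPrimePowBall F ι₁ (m - N₁)} :=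
          (isClosed_preimage_piPrimePowBall (Zm s) (m - N₁)).measurableSet
        calc ∫⁻ ζ, ‖V (glue e (Zm s ζ) s)‖ₑ ∂(Measure.pi fun _ : κ => μ)
            ≤ ∫⁻ ζ, {ζ' : κ → F | Zm s ζ' ∈ piPrimePowBall F ι₁ (m - N₁)}.indicator (fun _ => ENNReal.ofReal K₁) ζ ∂(Measure.pi fun _ : κ => μ) := by
              refine lintegral_mono fun ζ => ?_
              have h := hVbound s ζ
              rwa [indicator_of_mem hsN] at h
          _ = ENNReal.ofReal K₁ * (Measure.pi fun _ : κ => μ) {ζ' : κ → F | Zm s ζ' ∈ piPrimePowBall F ι₁ (m - N₁)} :=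
              lintegral_indicator_const hmeas _
          _ ≤ ENNReal.ofReal K₁ * (Measure.pi fun _ : κ => μ) (piPrimePowBall F κ (m - N₁ - level s - c₀)) := by gcongr
          _ = W s := by
              rw [hW]
              simp only [indicator_of_notMem (show s ∉ ({0} : Set (ι₁' → F)) from hs0), indicator_of_mem hsN, zero_add, hf]
              rw [measureReal_def, ENNReal.ofReal_mul hK₁0, ENNReal.ofReal_toReal (measure_piPrimePowBall_lt_top _ _).ne]
      · have h0 : ∀ ζ, ‖V (glue e (Zm s ζ) s)‖ₑ = 0 := by
          intro ζ
          have h := hVbound s ζ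
          rw [indicator_of_notMem hsN] at h
          exact le_antisymm h bot_le
        simp only [h0, lintegral_zero]
        exact bot_le
    · have hWm : Measurable fun s => ({0} : Set (ι₁' → F)).indicator (fun _ => (∞ : ℝ≥0∞)) s :=
        measurable_const.indicator (measurableSet_singleton 0)
      rw [hW, lintegral_add_left hWm, lintegral_indicator_const (measurableSet_singleton 0), hσ0, mul_zero, zero_add,
        lintegral_indicator (Literature.NumberTheory.Weil1965.SplitPlace.measurableSet_piPrimePowBall' N)]
      set K₀ : ℝ := K₁ * (Measure.pi fun _ : κ => μ).real (piPrimePowBall F κ (m - N₁ - N - c₀)) with hK₀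
      have hK₀0 : 0 ≤ K₀ := by positivity
      refine setLIntegral_lt_top_of_shell_bound σ hσ0 N f (Cf := ENNReal.ofReal K₀) (r := ENNReal.ofReal ((residueFieldCard F : ℝ) ^ Fintype.card κ))
        (Cσ := ENNReal.ofReal (σ.real (piPrimePowBall F ι₁' N)))
        (ρ := ENNReal.ofReal ((((residueFieldCard F : ℝ) ^ Fintype.card ι₁')⁻¹ * (residueFieldCard F : ℝ) ^ 2)))
        ENNReal.ofReal_ne_top ENNReal.ofReal_ne_top ?_ (fun k s hs hs' => ?_) (fun k => ?_)
      · rw [← ENNReal.ofReal_mul (pow_nonneg hq0.le _), ← ENNReal.ofReal_one]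
        refine (ENNReal.ofReal_lt_ofReal_iff_of_nonneg (by positivity)).2 ?_
        rw [← mul_assoc, mul_comm ((residueFieldCard F : ℝ) ^ Fintype.card κ), mul_assoc, inv_mul_lt_iff₀ (pow_pos hq0 _), mul_one, ← pow_add]
        exact pow_lt_pow_right₀ hq1 (by omega)
      · have hlev : level s = N + k := level_eq_of_mem_shell ⟨hs, hs'⟩
        rw [hf]
        dsimp only
        rw [hlev, show m - N₁ - (N + (k : ℤ)) - c₀ = (m - N₁ - N - c₀) - k by ring, measureReal_pi_piPrimePowBall_sub_natCast μ,
          ← ENNReal.ofReal_pow (pow_nonneg hq0.le _), ← ENNReal.ofReal_mul hK₀0]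
        refine ENNReal.ofReal_le_ofReal (le_of_eq ?_)
        rw [hK₀]
        ring
      · exact measure_piPrimePowBall_le_of_vertexLaw σ (by positivity) hlaw N k
  -- swap the factors
  have h := (integrable_swap_iff (μ := σ) (ν := Measure.pi fun _ : κ => μ)
    (f := fun p : (ι₁' → F) × (κ → F) => V (glue e (Zm p.1 p.2) p.1))).2 hswap
  exact h

end I1

end Summit.HodgeConjecture.HodgeConjecture.Cruxes.HLiu418.K2LiuConeWordIntegrabilityZeta

end
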